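import Mathlib
import Literature.Computability.AlgebraicComplexity.GroupTheoreticMatMul

set_option linter.dupNamespace false

/-!
# Chart-USP implies STPP (Cohn–Kleinberg–Szegedy–Umans 2005, Thm. 37) in the tree's `IsSTPP` threading

Stub `stub_chartSTPP` of the line `tame-charts` for the crux
`Summit.MatrixMultiplication.MatrixMultiplication.Theses.ThinBlockAlpha.BoundedExponentThird`.

A *chart* assigns to every symbol `x : Fin k` three finite subsets `SA x, SB x, SC x` of an additive
abelian group `Z`, each triple satisfying the triple product property (`hT`).  Rows
`row i : Fin n → Fin k` give product blocks `∏_c SA (row i c)` (as `Fintype.piFinset`) in `Fin n → Z`.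
The local chart-USP hypothesis `hU` says that every index triple `(i, j, l)` which is not constant has
a coordinate `c` at which the symbol pattern `(row i c, row j c, row l c)` admits NO solution of the
STPP relation threaded exactly as `IsSTPP` threads `(i, j, k)`.  Conclusion: the family of product
blocks has the simultaneous triple product property `IsSTPP`.

Proof: the STPP relation in `Fin n → Z` holds coordinatewise; off the diagonal the separating
coordinate of `hU` is contradicted by the coordinate witnesses, and on the diagonal `i = j = l` the
symbols' triple product property gives equality of the elements coordinate by coordinate (`funext`).
-/

namespace Summit.MatrixMultiplication.MatrixMultiplication.Theorems.BoundedExponentThird.TameCharts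

open Literature.Computability.AlgebraicComplexity

/-- **CKSU 2005 Thm. 37 in the tree threading** (local chart-USP ⟹ STPP): if every symbol's triple
`(SA x, SB x, SC x)` has the triple product property and every non-constant index triple of rows has
a coordinate whose symbol pattern carries no solution of the STPP relation, then the product blocks
`(∏_c SA (row i c), ∏_c SB (row i c), ∏_c SC (row i c))_{i < L}` form an `IsSTPP` family in
`Fin n → Z`. -/
theorem stub_chartSTPP
    (Z : Type) [AddCommGroup Z] (k : ℕ) (SA SB SC : Fin k → Finset Z)
    (hT : ∀ x, ∀ a ∈ SA x, ∀ a' ∈ SA x, ∀ b ∈ SB x, ∀ b' ∈ SB x, ∀ c ∈ SC x, ∀ c' ∈ SC x,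
      (a' - a) + (b' - b) + (c' - c) = 0 → a = a' ∧ b = b' ∧ c = c')
    (n L : ℕ) (row : Fin L → Fin n → Fin k)
    (hU : ∀ i j l : Fin L, ¬ (i = j ∧ j = l) → ∃ c : Fin n,
      ¬ ∃ s' ∈ SA (row i c), ∃ s ∈ SA (row l c), ∃ t' ∈ SB (row j c), ∃ t ∈ SB (row i c),
          ∃ u' ∈ SC (row l c), ∃ u ∈ SC (row j c), (s' - s) + (t' - t) + (u' - u) = 0) :
    IsSTPP (fun i => Fintype.piFinset fun c => SA (row i c))
      (fun i => Fintype.piFinset fun c => SB (row i c))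
      (fun i => Fintype.piFinset fun c => SC (row i c)) := by
  intro i j l s hs s' hs' t ht t' ht' u hu u' hu' h0
  simp only [Fintype.mem_piFinset] at hs hs' ht ht' hu hu'
  have hc : ∀ c, (s' c - s c) + (t' c - t c) + (u' c - u c) = 0 := fun c => by
    have := congr_fun h0 c
    simpa using this
  by_cases hijl : i = j ∧ j = l
  · obtain ⟨rfl, rfl⟩ := hijl
    refine ⟨rfl, rfl, ?_, ?_, ?_⟩
    · funext c
      exact (hT _ _ (hs c) _ (hs' c) _ (ht c) _ (ht' c) _ (hu c) _ (hu' c) (hc c)).1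
    · funext c
      exact (hT _ _ (hs c) _ (hs' c) _ (ht c) _ (ht' c) _ (hu c) _ (hu' c) (hc c)).2.1
    · funext c
      exact (hT _ _ (hs c) _ (hs' c) _ (ht c) _ (ht' c) _ (hu c) _ (hu' c) (hc c)).2.2
  · exfalso
    obtain ⟨c, hc'⟩ := hU i j l hijl
    exact hc' ⟨s' c, hs' c, s c, hs c, t' c, ht' c, t c, ht c, u' c, hu' c, u c, hu c, hc c⟩

end Summit.MatrixMultiplication.MatrixMultiplication.Theorems.BoundedExponentThird.TameCharts
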